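import Literature.NumberTheory.Sieve.MoebiusShiftedPrimesDirichletMeanValue
import Literature.NumberTheory.LFunctions.FejerSmoothedIndicator
import HarnessLib

/-!
# Möbius on shifted primes — the smoothed first Ramaré decomposition (Lichtman 2020, §5.1, repaired)

Topic `Literature/NumberTheory/Sieve`, part of the decomposition of the named fact
`Literature.NumberTheory.Sieve.Lichtman2020_majorArcEstimate` (J. D. Lichtman, *Averages of the Möbius
function on shifted primes*, Q. J. Math. 73 (2022) 729–757, arXiv:2009.08969v2 [Lichtman2020],
Proposition 3.2) AT THE PRINTED EXPONENT `P₁ = (log X)^{33A}` of the typical set `S = S(X,A,δ)`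
((2.3)–(2.4)).  Everything in this file is PROVED; there are no named facts.

## Why a new decomposition

`MoebiusShiftedPrimesTypical.lean` records the gap in the printed proof of Proposition 5.1 (p. 15,
"Bound for `E₁`"): with Lemma 4.7 (= Matomäki–Radziwiłł, Lemma 12) the first Ramaré decomposition of
`G(s) = ∑_{Y ≤ n ≤ 2Y, n ∈ S} λχ(n) n^{-s}` along `[P₁, Q₁]` costs a boundary error `(T/Y+1)/V` (the
replacement of `{m : pm ∈ [Y,2Y]}` by the block window `M_v`), which forces the block fineness
`V ≥ (log X)^B`, `B = 11A`, and then Cauchy–Schwarz over the `≍ V log Q₁` blocks and the geometric series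
give `E₁ ≍ V² P₁^{-2α}`, a saving only when `P₁ ≥ (log X)^{66A+}`; the tree therefore re-targeted the
whole chain to `S_c`, `c ≥ 100`.  Here the first decomposition is made EXACT by smoothing, so that `V`
becomes a numerical constant (`V = 2` downstream) and `E₁ ≍ P₁^{-2α}` up to `(log log X)`-type factors,
which the printed `P₁ = (log X)^{33A}` affords (`α = 1/5`: `P₁^{-2α} = (log X)^{-13.2A} ≤ (log X)^{-11A}`).

## Content

For sequences `a, b, c` with `a(mp) = b(m)c(p)` for all `m` and all primes `p ∈ [P, Q]` (true for
`a = λχ𝟙_S`, `c = λχ`, `b = λχ𝟙_{HasPF[P₂,Q₂]}` by complete multiplicativity), a real weight `γ`, and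
the range `[N₁, N₂]`:
* `pairSet` (`A_p = {m : pm ∈ [N₁,N₂]}`), `wideWindow` (`M_v = [N₁e^{-(v+1)/V}, N₂e^{-v/V}] ⊇ A_p`,
  `pairSet_subset_wideWindow`), `wideCofactorPoly` (`R⁺_v`), `sepPoly` (`F = ∑_v Q_v R⁺_v`, `Q_v` the
  tree's `blockPrimePoly`);
* `decomposition'` — the EXACT identity `∑_{N₁ ≤ n ≤ N₂} γ_n a_n n^{-s} = Main⁺ - D + E_sq`
  (`Main⁺` over the pairs `(p, m ∈ M_{v(p)})`, `D` over `M_{v(p)} ∖ A_p`, `E_sq` over `p ∣ m`), from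
  `∑_{p ∣ n} 1/ω(n) = 1` (`sum_dvd_eq_sum_pairs'`, as MR Lemma 12 / the tree's `MatomakiRadziwillLemma12`);
* `mainPlus_eq_integral` — for `γ_n = γ(log n)` with `γ` the Fejér-smoothed indicator of
  `FejerSmoothedIndicator.lean`: `Main⁺(1+it) = ∫_{-2λ}^{2λ} Γ(u) F(1+i(t-u)) du` (band-limited
  representation + the shift identity `e^{iu log(pm)}(pm)^{-1-it} = (pm)^{-1-i(t-u)}`): the variables `p`
  and `m` are separated exactly, at the price of an average over shifts `|u| ≤ 2λ`;
* `norm_sq_sepPoly_le_of_good`, `norm_sq_mainPlus_le` — at a point all of whose shifts are good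
  (`‖Q_v‖ ≤ e^{-αv/V}` for all `v`), weighted Cauchy–Schwarz over `v` (weights `e^{∓αv/V}`) and over `u`
  (weight `‖Γ‖`) give `‖Main⁺(t)‖² ≤ (∫‖Γ‖) Λ ∫ ‖Γ(u)‖ Ψ(t-u) du`, `Λ = ∑_v e^{-αv/V}`,
  `Ψ = ∑_v e^{-αv/V} ‖R⁺_v‖²`;
* `goodPart_mainPlus_le` — Fubini on `[n,n+1] × [-2λ,2λ]`, the shift `t ↦ t - u` and the mean value
  theorem window by window: `∑_{n good} ∫_n^{n+1} ‖Main⁺‖² ≤ (∫‖Γ‖)² Λ ∑_v e^{-αv/V} ∫_{-T''}^{T''} ‖R⁺_v‖²`;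
  `goodPart_mainPlus_le'` — the explicit form with `∫_{-T}^{T} ‖R⁺_v‖² ≤ (k+1)(5Te^{(v+1)/V}/N₁ + 18k)`
  (`N₂e^{1/V} ≤ kN₁`, Lemma 4.1) and the geometric sums `blockSum_le` (`Λ ≤ e^{α/V}P^{-α}(1+V/α)`),
  `blockSum_window_le`.

The mean values of `D`, `E_sq` and of the smoothing error `G - G_γ`, and the assembly on the good
intervals, are in `MoebiusShiftedPrimesSmoothedMeanValues.lean`.

## References

* J. D. Lichtman, arXiv:2009.08969v2, §5.1 (Proposition 5.1 and the bound for `E₁`, pp. 14–15)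
  [Lichtman2020].
* K. Matomäki, M. Radziwiłł, Ann. of Math. (2) 183 (2016), Lemma 12 [MatomakiRadziwillAnnals2016].
-/

noncomputable section

open Finset Real Complex MeasureTheory Filter
open scoped Topology

namespace Literature.NumberTheory.Sieve.Lichtman2020.Smoothed

open MatomakiRadziwillLemma12 Literature.NumberTheory.LFunctions.FejerSmoothing

/-- The primes of `[P, Q]`. -/
local notation "Pr[" P ", " Q "]" => Finset.filter Nat.Prime (Finset.Icc ⌈(P : ℝ)⌉₊ ⌊(Q : ℝ)⌋₊)
/-- `n^{-1-it}`. -/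
local notation "cw[" t ", " n "]" => (((n : ℕ) : ℂ) ^ (-(1 + ((t : ℝ) : ℂ) * Complex.I)))
/-- The weight `1/(ω(m) + 1)`. -/
local notation "wt[" P ", " Q ", " m "]" => ((1 : ℂ) / ((primeDivisorsIn P Q m : ℂ) + 1))

/-! ### The pair sets, the wide cofactor windows and polynomials -/

/-- `A_p = {1 ≤ m ≤ N₂ : N₁ ≤ pm ≤ N₂}`. [folklore] -/
def pairSet (N₁ N₂ p : ℕ) : Finset ℕ := (Icc 1 N₂).filter (fun m => p * m ∈ Icc N₁ N₂)

/-- The wide cofactor window `M_v = [N₁ e^{-(v+1)/V}, N₂ e^{-v/V}] ∩ ℕ` of the block `v`. [folklore] -/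
def wideWindow (N₁ N₂ : ℕ) (V : ℝ) (v : ℕ) : Finset ℕ :=
  Icc ⌈(N₁ : ℝ) * Real.exp (-(((v : ℝ) + 1) / V))⌉₊ ⌊(N₂ : ℝ) * Real.exp (-((v : ℝ) / V))⌋₊

/-- The wide cofactor polynomial `R⁺_v(1+it) = ∑_{m ∈ M_v} b_m m^{-1-it}/(ω(m)+1)`. [folklore] -/
def wideCofactorPoly (b : ℕ → ℂ) (P Q : ℝ) (N₁ N₂ : ℕ) (V : ℝ) (v : ℕ) (t : ℝ) : ℂ :=
  ∑ m ∈ wideWindow N₁ N₂ V v, b m * wt[P, Q, m] * cw[t, m]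

/-- The separated main polynomial `F(1+it) = ∑_{v ∈ ℐ} Q_v(1+it) R⁺_v(1+it)`,
`ℐ = [⌊V log P⌋, ⌊V log Q⌋]`. [folklore] -/
def sepPoly (b c : ℕ → ℂ) (P Q : ℝ) (N₁ N₂ : ℕ) (V : ℝ) (t : ℝ) : ℂ :=
  ∑ v ∈ Icc ⌊V * Real.log P⌋₊ ⌊V * Real.log Q⌋₊,
    blockPrimePoly c P Q V v t * wideCofactorPoly b P Q N₁ N₂ V v t

/-- Members of `pairSet` are `≥ 1`, `≤ N₂`, with `N₁ ≤ pm ≤ N₂`. [folklore] -/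
theorem mem_pairSet {N₁ N₂ p m : ℕ} :
    m ∈ pairSet N₁ N₂ p ↔ (1 ≤ m ∧ m ≤ N₂) ∧ (N₁ ≤ p * m ∧ p * m ≤ N₂) := by
  simp [pairSet, Finset.mem_filter, Finset.mem_Icc]

/-- `A_p ⊆ M_{v(p)}` with `v(p) = ⌊V log p⌋` (`p ≥ 1`, `V > 0`). [folklore] -/
theorem pairSet_subset_wideWindow {N₁ N₂ : ℕ} {V : ℝ} (hV : 0 < V) {p : ℕ} (hp : 1 ≤ p) :
    pairSet N₁ N₂ p ⊆ wideWindow N₁ N₂ V ⌊V * Real.log p⌋₊ := by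
  intro m hm
  rw [mem_pairSet] at hm
  obtain ⟨⟨hm1, -⟩, hlo, hhi⟩ := hm
  obtain ⟨hb1, hb2⟩ := (block_iff hV hp _).2 rfl
  set v := ⌊V * Real.log p⌋₊ with hv
  have hp0 : (0 : ℝ) < p := by exact_mod_cast hp
  have hm0 : (0 : ℝ) < m := by exact_mod_cast hm1
  have hlo' : (N₁ : ℝ) ≤ p * m := by exact_mod_cast hlo
  have hhi' : (p : ℝ) * m ≤ N₂ := by exact_mod_cast hhi
  unfold wideWindow
  rw [Finset.mem_Icc]
  constructor
  · -- `m ≥ N₁/p > N₁ e^{-(v+1)/V}`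
    refine Nat.ceil_le.2 ?_
    have h1 : (N₁ : ℝ) * Real.exp (-(((v : ℝ) + 1) / V)) ≤ (p * m) * Real.exp (-(((v : ℝ) + 1) / V)) :=
      mul_le_mul_of_nonneg_right hlo' (Real.exp_pos _).le
    have h2 : (p : ℝ) * Real.exp (-(((v : ℝ) + 1) / V)) ≤ 1 := by
      have e : Real.exp (((v : ℝ) + 1) / V) * Real.exp (-(((v : ℝ) + 1) / V)) = 1 := by
        rw [← Real.exp_add]; simp
      calc (p : ℝ) * Real.exp (-(((v : ℝ) + 1) / V))
          ≤ Real.exp (((v : ℝ) + 1) / V) * Real.exp (-(((v : ℝ) + 1) / V)) :=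
            mul_le_mul_of_nonneg_right hb2.le (Real.exp_pos _).le
        _ = 1 := e
    calc (N₁ : ℝ) * Real.exp (-(((v : ℝ) + 1) / V)) ≤ (p * m) * Real.exp (-(((v : ℝ) + 1) / V)) := h1
      _ = ((p : ℝ) * Real.exp (-(((v : ℝ) + 1) / V))) * m := by ring
      _ ≤ 1 * m := mul_le_mul_of_nonneg_right h2 hm0.le
      _ = m := one_mul _
  · -- `m ≤ N₂/p ≤ N₂ e^{-v/V}`
    refine Nat.le_floor ?_
    have e : Real.exp ((v : ℝ) / V) * Real.exp (-((v : ℝ) / V)) = 1 := by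
      rw [← Real.exp_add]; simp
    have h1 : (m : ℝ) * Real.exp ((v : ℝ) / V) ≤ N₂ :=
      calc (m : ℝ) * Real.exp ((v : ℝ) / V) ≤ m * p := mul_le_mul_of_nonneg_left hb1 hm0.le
        _ = p * m := by ring
        _ ≤ N₂ := hhi'
    calc (m : ℝ) = m * (Real.exp ((v : ℝ) / V) * Real.exp (-((v : ℝ) / V))) := by rw [e, mul_one]
      _ = (m * Real.exp ((v : ℝ) / V)) * Real.exp (-((v : ℝ) / V)) := by ring
      _ ≤ N₂ * Real.exp (-((v : ℝ) / V)) := mul_le_mul_of_nonneg_right h1 (Real.exp_pos _).le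

/-! ### Regrouping the smoothed sum over the pairs `(p, m)` -/

/-- **The smoothed sum over pairs**: with `ω(n) ≥ 1` on the support,
`∑_{N₁ ≤ n ≤ N₂, (n,𝒫)≠1} f(n) n^{-1-it} = ∑_{p ∈ 𝒫} ∑_{m ∈ A_p} f(pm)/ω(pm) (pm)^{-1-it}` (`N₁ ≥ 1`).
[cite: MatomakiRadziwillAnnals2016, Lemma 12] -/
theorem sum_dvd_eq_sum_pairs' {N₁ N₂ : ℕ} (hN₁ : 1 ≤ N₁) (P Q : ℝ) (f : ℕ → ℂ) (t : ℝ) :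
    ∑ n ∈ (Icc N₁ N₂).filter (fun n => ¬ ∀ p ∈ Pr[P, Q], ¬ p ∣ n), f n * cw[t, n] =
      ∑ p ∈ Pr[P, Q], ∑ m ∈ pairSet N₁ N₂ p,
        f (p * m) / (primeDivisorsIn P Q (p * m) : ℂ) * cw[t, p * m] := by
  have hPs : ∀ p ∈ Pr[P, Q], 0 < p := fun p hp => (mem_filter.1 hp).2.pos
  have hS : ∀ p ∈ Pr[P, Q], ∀ m ∈ pairSet N₁ N₂ p, 1 ≤ m ∧ p * m ≤ N₂ := by
    intro p _ m hm
    rw [mem_pairSet] at hm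
    exact ⟨hm.1.1, hm.2.2⟩
  rw [sum_pairs_eq (Pr[P, Q]) hPs (fun p => pairSet N₁ N₂ p) N₂ hS
    (fun p m => f (p * m) / (primeDivisorsIn P Q (p * m) : ℂ)) (fun n => cw[t, n])]
  symm
  have hsub0 : Icc N₁ N₂ ⊆ Icc 1 N₂ := fun n hn => by
    rw [mem_Icc] at hn ⊢; omega
  have hsub : (Icc N₁ N₂).filter (fun n => ¬ ∀ p ∈ Pr[P, Q], ¬ p ∣ n) ⊆ Icc 1 N₂ :=
    (filter_subset _ _).trans hsub0
  rw [← sum_subset hsub ?zero]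
  case zero =>
    intro n hn hnot
    have : (Pr[P, Q]).filter (fun p => p ∣ n ∧ n / p ∈ pairSet N₁ N₂ p) = ∅ ∨
        n ∈ (Icc N₁ N₂).filter (fun n => ¬ ∀ p ∈ Pr[P, Q], ¬ p ∣ n) := by
      by_cases h : (Pr[P, Q]).filter (fun p => p ∣ n ∧ n / p ∈ pairSet N₁ N₂ p) = ∅
      · exact Or.inl h
      · right
        obtain ⟨p, hp⟩ := nonempty_iff_ne_empty.2 h
        rw [mem_filter] at hp
        obtain ⟨hp, hpn, hm⟩ := hp
        rw [mem_pairSet, Nat.mul_div_cancel' hpn] at hm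
        rw [mem_filter, mem_Icc]
        exact ⟨hm.2, fun hall => hall p hp hpn⟩
    rcases this with h | h
    · rw [h, sum_empty, zero_mul]
    · exact absurd h hnot
  refine sum_congr rfl fun n hn => ?_
  rw [mem_filter] at hn
  obtain ⟨hnN, hdiv⟩ := hn
  have hn1 : 1 ≤ n := (mem_Icc.1 (hsub0 hnN)).1
  have hfilt : (Pr[P, Q]).filter (fun p => p ∣ n ∧ n / p ∈ pairSet N₁ N₂ p) =
      (Pr[P, Q]).filter (· ∣ n) := by
    ext p
    simp only [mem_filter, and_congr_right_iff]
    intro hp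
    constructor
    · exact And.left
    · intro hd
      refine ⟨hd, ?_⟩
      rw [mem_pairSet, Nat.mul_div_cancel' hd]
      refine ⟨⟨Nat.div_pos (Nat.le_of_dvd hn1 hd) hp.2.pos, (Nat.div_le_self _ _).trans ?_⟩,
        mem_Icc.1 hnN⟩
      exact (mem_Icc.1 hnN).2
  rw [hfilt]
  have hcongr : ∀ p ∈ (Pr[P, Q]).filter (· ∣ n),
      f (p * (n / p)) / (primeDivisorsIn P Q (p * (n / p)) : ℂ) = f n / (primeDivisorsIn P Q n : ℂ) := by
    intro p hp
    rw [Nat.mul_div_cancel' (mem_filter.1 hp).2]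
  rw [sum_congr rfl hcongr, sum_const, nsmul_eq_mul, ← primeDivisorsIn_eq]
  have hω : (primeDivisorsIn P Q n : ℂ) ≠ 0 := by
    rw [primeDivisorsIn_eq, Nat.cast_ne_zero, ← pos_iff_ne_zero, card_pos]
    push Not at hdiv
    obtain ⟨p, hp, hpn⟩ := hdiv
    exact ⟨p, mem_filter.2 ⟨hp, hpn⟩⟩
  rw [mul_div_cancel₀ _ hω]

/-- **The separated main term**: grouping the primes by blocks,
`∑_p c_p p^{-s} ∑_{m ∈ M_{v(p)}} b_m w_m m^{-s} = F(s) = ∑_{v ∈ ℐ} Q_v(s) R⁺_v(s)`.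
[cite: MatomakiRadziwillAnnals2016, Lemma 12] -/
theorem main_eq' {P Q V : ℝ} (hP : 1 ≤ P) (hPQ : P ≤ Q) (hV : 0 < V) (N₁ N₂ : ℕ) (b c : ℕ → ℂ)
    (t : ℝ) :
    ∑ p ∈ Pr[P, Q], ∑ m ∈ wideWindow N₁ N₂ V ⌊V * Real.log p⌋₊,
        c p * b m * wt[P, Q, m] * cw[t, p * m] = sepPoly b c P Q N₁ N₂ V t := by
  have hQ0 : 0 ≤ Q := by linarith
  have hmaps : ∀ p ∈ Pr[P, Q], ⌊V * Real.log p⌋₊ ∈ Icc ⌊V * Real.log P⌋₊ ⌊V * Real.log Q⌋₊ := by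
    intro p hp
    rw [mem_Pr hQ0] at hp
    obtain ⟨hp, hPp, hpQ⟩ := hp
    have hp0 : (0 : ℝ) < p := by exact_mod_cast hp.pos
    rw [mem_Icc]
    exact ⟨Nat.floor_le_floor (mul_le_mul_of_nonneg_left (Real.log_le_log (by linarith) hPp) hV.le),
      Nat.floor_le_floor (mul_le_mul_of_nonneg_left (Real.log_le_log hp0 hpQ) hV.le)⟩
  unfold sepPoly
  rw [← sum_fiberwise_of_maps_to hmaps]
  refine sum_congr rfl fun j _ => ?_
  have inner : ∀ p ∈ (Pr[P, Q]).filter (fun p : ℕ => ⌊V * Real.log (p : ℝ)⌋₊ = j),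
      ∑ m ∈ wideWindow N₁ N₂ V ⌊V * Real.log p⌋₊, c p * b m * wt[P, Q, m] * cw[t, p * m] =
        c p * cw[t, p] * ∑ m ∈ wideWindow N₁ N₂ V j, b m * wt[P, Q, m] * cw[t, m] := by
    intro p hp
    rw [(mem_filter.1 hp).2, mul_sum]
    refine sum_congr rfl fun m _ => ?_
    rw [cpw_mul]
    ring
  rw [sum_congr rfl inner, ← sum_mul]
  congr 1
  rw [blockPrimePoly]
  refine sum_congr ?_ fun p _ => rfl
  ext p
  simp only [mem_filter, and_congr_right_iff]
  intro hp
  exact (block_iff hV hp.2.one_lt.le j).symm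

/-- **The smoothed Ramaré decomposition** (exact; no range replacement).  Let `a, b, c` be sequences with
`a(mp) = b(m)c(p)` for every `m` and every prime `p ∈ [P, Q]`, `a(n) = 0` unless `n` has a prime factor
among the primes of `[⌈P⌉, ⌊Q⌋]`, and let `γ` be any real weight.  Then for `1 ≤ N₁`,
`∑_{N₁ ≤ n ≤ N₂} γ_n a_n n^{-s} = Main⁺ - D + E_sq` with
`Main⁺ = ∑_p ∑_{m ∈ M_{v(p)}} γ_{pm} c_p b_m w_m (pm)^{-s}`, `D` the same over `m ∈ M_{v(p)} ∖ A_p`, and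
`E_sq = ∑_p ∑_{m ∈ A_p, p ∣ m} γ_{pm} c_p b_m (1/ω(m) - 1/(ω(m)+1)) (pm)^{-s}` (`s = 1 + it`).
[cite: Lichtman2020, §5.1, proof of Proposition 5.1] -/
theorem decomposition' {P Q V : ℝ} (hP : 1 ≤ P) (hPQ : P ≤ Q) (hV : 0 < V) {N₁ N₂ : ℕ} (hN₁ : 1 ≤ N₁)
    (a b c : ℕ → ℂ) (γ : ℕ → ℝ)
    (hfac : ∀ m p : ℕ, p.Prime → P ≤ p → (p : ℝ) ≤ Q → a (m * p) = b m * c p)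
    (hcop : ∀ n, (∀ p ∈ Pr[P, Q], ¬ p ∣ n) → a n = 0) (t : ℝ) :
    ∑ n ∈ Icc N₁ N₂, (γ n : ℂ) * a n * cw[t, n] =
      (∑ p ∈ Pr[P, Q], ∑ m ∈ wideWindow N₁ N₂ V ⌊V * Real.log p⌋₊,
          (γ (p * m) : ℂ) * (c p * b m * wt[P, Q, m]) * cw[t, p * m])
      - (∑ p ∈ Pr[P, Q], ∑ m ∈ wideWindow N₁ N₂ V ⌊V * Real.log p⌋₊ \ pairSet N₁ N₂ p,
          (γ (p * m) : ℂ) * (c p * b m * wt[P, Q, m]) * cw[t, p * m])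
      + ∑ p ∈ Pr[P, Q], ∑ m ∈ (pairSet N₁ N₂ p).filter (fun m => p ∣ m),
          (γ (p * m) : ℂ) * (c p * b m *
            (1 / (primeDivisorsIn P Q m : ℂ) - 1 / ((primeDivisorsIn P Q m : ℂ) + 1))) * cw[t, p * m] := by
  have hQ0 : 0 ≤ Q := by linarith
  have hPr : ∀ p ∈ Pr[P, Q], p.Prime := fun p hp => (mem_filter.1 hp).2
  -- the coprime part vanishes
  have s1 : ∑ n ∈ Icc N₁ N₂, (γ n : ℂ) * a n * cw[t, n] =
      ∑ n ∈ (Icc N₁ N₂).filter (fun n => ¬ ∀ p ∈ Pr[P, Q], ¬ p ∣ n), ((γ n : ℂ) * a n) * cw[t, n] := by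
    rw [sum_filter_of_ne]
    intro n _ hne hall
    apply hne
    rw [hcop n hall, mul_zero, zero_mul]
  -- regroup over pairs
  have s2 := sum_dvd_eq_sum_pairs' (N₂ := N₂) hN₁ P Q (fun n => (γ n : ℂ) * a n) t
  -- split each `A_p` sum: `a(pm)/ω(pm) = c b w + [p ∣ m] c b (1/ω(m) - 1/(ω(m)+1))`
  have s3 : ∀ p ∈ Pr[P, Q], ∑ m ∈ pairSet N₁ N₂ p,
      (γ (p * m) : ℂ) * a (p * m) / (primeDivisorsIn P Q (p * m) : ℂ) * cw[t, p * m] =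
      (∑ m ∈ pairSet N₁ N₂ p, (γ (p * m) : ℂ) * (c p * b m * wt[P, Q, m]) * cw[t, p * m])
      + ∑ m ∈ (pairSet N₁ N₂ p).filter (fun m => p ∣ m),
          (γ (p * m) : ℂ) * (c p * b m *
            (1 / (primeDivisorsIn P Q m : ℂ) - 1 / ((primeDivisorsIn P Q m : ℂ) + 1))) * cw[t, p * m] := by
    intro p hp'
    obtain ⟨hpp, hPp, hpQ⟩ := (mem_Pr hQ0).1 hp'
    rw [← sum_filter_add_sum_filter_not (pairSet N₁ N₂ p) (fun m => p ∣ m)]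
    rw [← sum_filter_add_sum_filter_not (pairSet N₁ N₂ p) (fun m => p ∣ m)
      (fun m => (γ (p * m) : ℂ) * (c p * b m * wt[P, Q, m]) * cw[t, p * m])]
    have hA : ∀ m ∈ (pairSet N₁ N₂ p).filter (fun m => p ∣ m),
        (γ (p * m) : ℂ) * a (p * m) / (primeDivisorsIn P Q (p * m) : ℂ) * cw[t, p * m] =
        (γ (p * m) : ℂ) * (c p * b m * wt[P, Q, m]) * cw[t, p * m]
          + (γ (p * m) : ℂ) * (c p * b m *
            (1 / (primeDivisorsIn P Q m : ℂ) - 1 / ((primeDivisorsIn P Q m : ℂ) + 1))) * cw[t, p * m] := by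
      intro m hm
      have hpm : p ∣ m := (mem_filter.1 hm).2
      have hω : primeDivisorsIn P Q (p * m) = primeDivisorsIn P Q m := by
        rw [primeDivisorsIn_eq, primeDivisorsIn_eq, filter_dvd_mul_eq_of_dvd _ hPr hp' hpm]
      rw [hω, show p * m = m * p from mul_comm p m, hfac m p hpp hPp hpQ]
      ring
    have hB : ∀ m ∈ (pairSet N₁ N₂ p).filter (fun m => ¬ p ∣ m),
        (γ (p * m) : ℂ) * a (p * m) / (primeDivisorsIn P Q (p * m) : ℂ) * cw[t, p * m] =
        (γ (p * m) : ℂ) * (c p * b m * wt[P, Q, m]) * cw[t, p * m] := by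
      intro m hm
      have hpm : ¬ p ∣ m := (mem_filter.1 hm).2
      have hω : primeDivisorsIn P Q (p * m) = primeDivisorsIn P Q m + 1 := by
        rw [primeDivisorsIn_eq, primeDivisorsIn_eq, card_filter_dvd_mul _ hPr hp' hpm]
      rw [hω, show p * m = m * p from mul_comm p m, hfac m p hpp hPp hpQ]
      push_cast
      ring
    rw [sum_congr rfl hA, sum_congr rfl hB, sum_add_distrib]
    ring
  -- `A_p ⊆ M_{v(p)}`: the sum over `A_p` is the sum over `M_{v(p)}` minus the sum over the difference
  have s4 : ∀ p ∈ Pr[P, Q],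
      ∑ m ∈ pairSet N₁ N₂ p, (γ (p * m) : ℂ) * (c p * b m * wt[P, Q, m]) * cw[t, p * m] =
      (∑ m ∈ wideWindow N₁ N₂ V ⌊V * Real.log p⌋₊, (γ (p * m) : ℂ) * (c p * b m * wt[P, Q, m]) * cw[t, p * m])
      - ∑ m ∈ wideWindow N₁ N₂ V ⌊V * Real.log p⌋₊ \ pairSet N₁ N₂ p,
          (γ (p * m) : ℂ) * (c p * b m * wt[P, Q, m]) * cw[t, p * m] := by
    intro p hp'
    have hp1 : 1 ≤ p := ((mem_Pr hQ0).1 hp').1.one_lt.le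
    have hsub := pairSet_subset_wideWindow (N₁ := N₁) (N₂ := N₂) hV hp1
    rw [← sum_sdiff hsub]
    ring
  have s2' : ∑ n ∈ (Icc N₁ N₂).filter (fun n => ¬ ∀ p ∈ Pr[P, Q], ¬ p ∣ n), ((γ n : ℂ) * a n) * cw[t, n] =
      ∑ p ∈ Pr[P, Q], ∑ m ∈ pairSet N₁ N₂ p,
        (γ (p * m) : ℂ) * a (p * m) / (primeDivisorsIn P Q (p * m) : ℂ) * cw[t, p * m] := by
    rw [s2]
  rw [s1, s2', sum_congr rfl s3, sum_add_distrib, sum_congr rfl s4, sum_sub_distrib]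

/-! ### The band-limited representation of the smoothed main term -/

/-- `u ↦ n^{-1-i(t-u)}` is continuous. [folklore] -/
theorem continuous_cpw_sub (n : ℕ) (t : ℝ) : Continuous fun u : ℝ => cw[t - u, n] :=
  (continuous_cpw n).comp (continuous_const.sub continuous_id)

/-- `s ↦ F(1+is)` is continuous. [folklore] -/
theorem continuous_sepPoly (b c : ℕ → ℂ) (P Q : ℝ) (N₁ N₂ : ℕ) (V : ℝ) :
    Continuous fun s : ℝ => sepPoly b c P Q N₁ N₂ V s := by
  unfold sepPoly wideCofactorPoly
  refine continuous_finsetSum _ fun v _ => (continuous_blockPrimePoly c P Q V v).mul ?_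
  exact continuous_finsetSum _ fun m _ => continuous_const.mul (continuous_cpw m)

/-- `s ↦ R⁺_v(1+is)` is continuous. [folklore] -/
theorem continuous_wideCofactorPoly (b : ℕ → ℂ) (P Q : ℝ) (N₁ N₂ : ℕ) (V : ℝ) (v : ℕ) :
    Continuous fun s : ℝ => wideCofactorPoly b P Q N₁ N₂ V v s := by
  unfold wideCofactorPoly
  exact continuous_finsetSum _ fun m _ => continuous_const.mul (continuous_cpw m)

/-- **One pair**: `γ(log n) K n^{-1-it} = ∫_{-2λ}^{2λ} Γ(u) K n^{-1-i(t-u)} du` (`n ≥ 1`), by the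
band-limited representation of `γ` and the shift identity. [folklore] -/
theorem smooth_pair_eq_integral {l b₁ b₂ : ℝ} (hl : 0 < l) (hb : b₁ ≤ b₂) {n : ℕ} (hn : n ≠ 0)
    (K : ℂ) (t : ℝ) :
    ((smoothIndicator l b₁ b₂ (Real.log n) : ℝ) : ℂ) * K * cw[t, n] =
      ∫ u in -(2 * l)..(2 * l), gammaFT (2 * l) b₁ b₂ u * (K * cw[t - u, n]) := by
  rw [smoothIndicator_eq_integral_gammaFT hl hb (Real.log n), ← intervalIntegral.integral_mul_const,
    ← intervalIntegral.integral_mul_const]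
  refine intervalIntegral.integral_congr fun u _ => ?_
  rw [← cexp_mul_log_mul_cpow hn u t]
  ring

/-- **The smoothed main term is a `Γ`-average of shifts of the separated polynomial**:
with `γ_n = γ(log n)`,
`∑_p ∑_{m ∈ M_{v(p)}} γ_{pm} c_p b_m w_m (pm)^{-1-it} = ∫_{-2λ}^{2λ} Γ(u) F(1+i(t-u)) du`.
[cite: Lichtman2020, §5.1, proof of Proposition 5.1] -/
theorem mainPlus_eq_integral {l b₁ b₂ P Q V : ℝ} (hl : 0 < l) (hb : b₁ ≤ b₂) (hP : 1 ≤ P)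
    (hPQ : P ≤ Q) (hV : 0 < V) {N₁ N₂ : ℕ} (hN₁ : 1 ≤ N₁) (b c : ℕ → ℂ) (t : ℝ) :
    ∑ p ∈ Pr[P, Q], ∑ m ∈ wideWindow N₁ N₂ V ⌊V * Real.log p⌋₊,
        ((smoothIndicator l b₁ b₂ (Real.log (p * m : ℕ)) : ℝ) : ℂ) * (c p * b m * wt[P, Q, m]) *
          cw[t, p * m] =
      ∫ u in -(2 * l)..(2 * l), gammaFT (2 * l) b₁ b₂ u * sepPoly b c P Q N₁ N₂ V (t - u) := by
  have hQ0 : 0 ≤ Q := by linarith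
  have hN₁0 : (0 : ℝ) < N₁ := by exact_mod_cast hN₁
  -- every pair has `pm ≠ 0`
  have hm1 : ∀ v : ℕ, ∀ m ∈ wideWindow N₁ N₂ V v, 1 ≤ m := by
    intro v m hm
    unfold wideWindow at hm
    have h1 := (mem_Icc.1 hm).1
    have h2 : 1 ≤ ⌈(N₁ : ℝ) * Real.exp (-(((v : ℝ) + 1) / V))⌉₊ :=
      Nat.one_le_iff_ne_zero.2 (Nat.ceil_pos.2 (mul_pos hN₁0 (Real.exp_pos _))).ne'
    exact h2.trans h1
  have hpm : ∀ p ∈ Pr[P, Q], ∀ m ∈ wideWindow N₁ N₂ V ⌊V * Real.log p⌋₊, p * m ≠ 0 := by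
    intro p hp m hm
    exact mul_ne_zero ((mem_Pr hQ0).1 hp).1.ne_zero (by have := hm1 _ m hm; omega)
  -- rewrite each pair as an integral
  have hpair : ∀ p ∈ Pr[P, Q], ∑ m ∈ wideWindow N₁ N₂ V ⌊V * Real.log p⌋₊,
      ((smoothIndicator l b₁ b₂ (Real.log (p * m : ℕ)) : ℝ) : ℂ) * (c p * b m * wt[P, Q, m]) * cw[t, p * m] =
      ∑ m ∈ wideWindow N₁ N₂ V ⌊V * Real.log p⌋₊, ∫ u in -(2 * l)..(2 * l),
        gammaFT (2 * l) b₁ b₂ u * ((c p * b m * wt[P, Q, m]) * cw[t - u, p * m]) := by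
    intro p hp
    refine sum_congr rfl fun m hm => ?_
    exact smooth_pair_eq_integral hl hb (hpm p hp m hm) _ t
  rw [sum_congr rfl hpair]
  -- continuity of the integrands
  have hcont : ∀ p m : ℕ, Continuous fun u : ℝ =>
      gammaFT (2 * l) b₁ b₂ u * ((c p * b m * wt[P, Q, m]) * cw[t - u, p * m]) :=
    fun p m => (continuous_gammaFT _ _ _).mul (continuous_const.mul (continuous_cpw_sub _ t))
  -- interchange the finite sums and the integral
  have hinner : ∀ p ∈ Pr[P, Q], ∑ m ∈ wideWindow N₁ N₂ V ⌊V * Real.log p⌋₊, ∫ u in -(2 * l)..(2 * l),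
      gammaFT (2 * l) b₁ b₂ u * ((c p * b m * wt[P, Q, m]) * cw[t - u, p * m]) =
      ∫ u in -(2 * l)..(2 * l), ∑ m ∈ wideWindow N₁ N₂ V ⌊V * Real.log p⌋₊,
        gammaFT (2 * l) b₁ b₂ u * ((c p * b m * wt[P, Q, m]) * cw[t - u, p * m]) := by
    intro p _
    rw [intervalIntegral.integral_finsetSum]
    exact fun m _ => (hcont p m).intervalIntegrable _ _
  rw [sum_congr rfl hinner, ← intervalIntegral.integral_finsetSum]
  swap
  · exact fun p _ => (continuous_finsetSum _ fun m _ => hcont p m).intervalIntegrable _ _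
  refine intervalIntegral.integral_congr fun u _ => ?_
  rw [← main_eq' hP hPQ hV N₁ N₂ b c (t - u), mul_sum]
  refine sum_congr rfl fun p _ => ?_
  rw [mul_sum]

/-! ### Pointwise bounds for the separated polynomial at good points -/

/-- `Ψ(s) = ∑_{v ∈ ℐ} e^{-αv/V} ‖R⁺_v(1+is)‖²`. [folklore] -/
def psiFun (b : ℕ → ℂ) (P Q : ℝ) (N₁ N₂ : ℕ) (V α : ℝ) (s : ℝ) : ℝ :=
  ∑ v ∈ Icc ⌊V * Real.log P⌋₊ ⌊V * Real.log Q⌋₊,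
    Real.exp (-(α * v / V)) * ‖wideCofactorPoly b P Q N₁ N₂ V v s‖ ^ 2

/-- `Ψ ≥ 0`. [folklore] -/
theorem psiFun_nonneg (b : ℕ → ℂ) (P Q : ℝ) (N₁ N₂ : ℕ) (V α s : ℝ) :
    0 ≤ psiFun b P Q N₁ N₂ V α s :=
  sum_nonneg fun v _ => by positivity

/-- `Ψ` is continuous. [folklore] -/
theorem continuous_psiFun (b : ℕ → ℂ) (P Q : ℝ) (N₁ N₂ : ℕ) (V α : ℝ) :
    Continuous (psiFun b P Q N₁ N₂ V α) := by
  unfold psiFun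
  exact continuous_finsetSum _ fun v _ =>
    continuous_const.mul ((continuous_wideCofactorPoly b P Q N₁ N₂ V v).norm.pow 2)

/-- **Weighted Cauchy–Schwarz over the blocks**: with `Λ = ∑_{v ∈ ℐ} e^{-αv/V}`,
`‖F(s)‖² ≤ Λ ∑_{v ∈ ℐ} e^{αv/V} ‖Q_v(s)‖² ‖R⁺_v(s)‖²`. [folklore] -/
theorem norm_sq_sepPoly_le (b c : ℕ → ℂ) (P Q : ℝ) (N₁ N₂ : ℕ) (V α s : ℝ) :
    ‖sepPoly b c P Q N₁ N₂ V s‖ ^ 2 ≤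
      (∑ v ∈ Icc ⌊V * Real.log P⌋₊ ⌊V * Real.log Q⌋₊, Real.exp (-(α * v / V))) *
        ∑ v ∈ Icc ⌊V * Real.log P⌋₊ ⌊V * Real.log Q⌋₊, Real.exp (α * v / V) *
          (‖blockPrimePoly c P Q V v s‖ ^ 2 * ‖wideCofactorPoly b P Q N₁ N₂ V v s‖ ^ 2) := by
  set ℐ := Icc ⌊V * Real.log P⌋₊ ⌊V * Real.log Q⌋₊ with hℐ
  set z : ℕ → ℂ := fun v => blockPrimePoly c P Q V v s * wideCofactorPoly b P Q N₁ N₂ V v s with hz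
  set f : ℕ → ℝ := fun v => Real.exp (-(α * v / (2 * V))) with hf
  set g : ℕ → ℝ := fun v => Real.exp (α * v / (2 * V)) * ‖z v‖ with hg
  have hfg : ∀ v, f v * g v = ‖z v‖ := fun v => by
    simp only [hf, hg]
    rw [← mul_assoc, ← Real.exp_add, show -(α * v / (2 * V)) + α * v / (2 * V) = 0 by ring,
      Real.exp_zero, one_mul]
  have hf2 : ∀ v, f v ^ 2 = Real.exp (-(α * v / V)) := fun v => by
    simp only [hf]; rw [← Real.exp_nat_mul]; congr 1; push_cast; ring
  have hg2 : ∀ v, g v ^ 2 = Real.exp (α * v / V) *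
      (‖blockPrimePoly c P Q V v s‖ ^ 2 * ‖wideCofactorPoly b P Q N₁ N₂ V v s‖ ^ 2) := fun v => by
    simp only [hg, hz]
    rw [mul_pow, ← Real.exp_nat_mul, norm_mul, mul_pow]
    congr 1; congr 1; push_cast; ring
  have h1 : ‖sepPoly b c P Q N₁ N₂ V s‖ ≤ ∑ v ∈ ℐ, f v * g v := by
    unfold sepPoly
    refine (norm_sum_le _ _).trans (le_of_eq ?_)
    exact sum_congr rfl fun v _ => (hfg v).symm
  have h0 : 0 ≤ ∑ v ∈ ℐ, f v * g v := sum_nonneg fun v _ => by rw [hfg]; exact norm_nonneg _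
  calc ‖sepPoly b c P Q N₁ N₂ V s‖ ^ 2 ≤ (∑ v ∈ ℐ, f v * g v) ^ 2 :=
        pow_le_pow_left₀ (norm_nonneg _) h1 2
    _ ≤ (∑ v ∈ ℐ, f v ^ 2) * ∑ v ∈ ℐ, g v ^ 2 := sum_mul_sq_le_sq_mul_sq _ _ _
    _ = _ := by simp_rw [hf2, hg2]

/-- At a point `s` where every block satisfies `‖Q_v(1+is)‖ ≤ e^{-αv/V}`:
`‖F(s)‖² ≤ Λ Ψ(s)`. [cite: Lichtman2020, §5.1, bound for E₁] -/
theorem norm_sq_sepPoly_le_of_good (b c : ℕ → ℂ) (P Q : ℝ) (N₁ N₂ : ℕ) (V α s : ℝ)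
    (hgood : ∀ v ∈ Icc ⌊V * Real.log P⌋₊ ⌊V * Real.log Q⌋₊,
      ‖blockPrimePoly c P Q V v s‖ ≤ Real.exp (-(α * v / V))) :
    ‖sepPoly b c P Q N₁ N₂ V s‖ ^ 2 ≤
      (∑ v ∈ Icc ⌊V * Real.log P⌋₊ ⌊V * Real.log Q⌋₊, Real.exp (-(α * v / V))) *
        psiFun b P Q N₁ N₂ V α s := by
  refine (norm_sq_sepPoly_le b c P Q N₁ N₂ V α s).trans ?_
  refine mul_le_mul_of_nonneg_left ?_ (sum_nonneg fun v _ => (Real.exp_pos _).le)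
  unfold psiFun
  refine sum_le_sum fun v hv => ?_
  have hq := hgood v hv
  have hq2 : ‖blockPrimePoly c P Q V v s‖ ^ 2 ≤ Real.exp (-(α * v / V)) ^ 2 :=
    pow_le_pow_left₀ (norm_nonneg _) hq 2
  have hR : 0 ≤ ‖wideCofactorPoly b P Q N₁ N₂ V v s‖ ^ 2 := by positivity
  calc Real.exp (α * v / V) * (‖blockPrimePoly c P Q V v s‖ ^ 2 * ‖wideCofactorPoly b P Q N₁ N₂ V v s‖ ^ 2)
      ≤ Real.exp (α * v / V) * (Real.exp (-(α * v / V)) ^ 2 * ‖wideCofactorPoly b P Q N₁ N₂ V v s‖ ^ 2) := by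
        gcongr
    _ = Real.exp (-(α * v / V)) * ‖wideCofactorPoly b P Q N₁ N₂ V v s‖ ^ 2 := by
        rw [← mul_assoc, sq, ← Real.exp_add, ← Real.exp_add]
        congr 2; ring

/-- **The smoothed main term at a point all of whose shifts are good**:
`‖∫ Γ(u) F(1+i(t-u)) du‖² ≤ (∫ ‖Γ‖) · Λ · ∫_{-2λ}^{2λ} ‖Γ(u)‖ Ψ(t-u) du`.
[cite: Lichtman2020, §5.1, bound for E₁] -/
theorem norm_sq_mainPlus_le {l b₁ b₂ : ℝ} (hl : 0 < l) (b c : ℕ → ℂ) (P Q : ℝ) (N₁ N₂ : ℕ)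
    (V α t : ℝ)
    (hgood : ∀ u ∈ Set.Icc (-(2 * l)) (2 * l), ∀ v ∈ Icc ⌊V * Real.log P⌋₊ ⌊V * Real.log Q⌋₊,
      ‖blockPrimePoly c P Q V v (t - u)‖ ≤ Real.exp (-(α * v / V))) :
    ‖∫ u in -(2 * l)..(2 * l), gammaFT (2 * l) b₁ b₂ u * sepPoly b c P Q N₁ N₂ V (t - u)‖ ^ 2 ≤
      (∫ u in -(2 * l)..(2 * l), ‖gammaFT (2 * l) b₁ b₂ u‖) *
        ((∑ v ∈ Icc ⌊V * Real.log P⌋₊ ⌊V * Real.log Q⌋₊, Real.exp (-(α * v / V))) *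
          ∫ u in -(2 * l)..(2 * l), ‖gammaFT (2 * l) b₁ b₂ u‖ * psiFun b P Q N₁ N₂ V α (t - u)) := by
  set Λ := ∑ v ∈ Icc ⌊V * Real.log P⌋₊ ⌊V * Real.log Q⌋₊, Real.exp (-(α * v / V)) with hΛ
  have hΛ0 : 0 ≤ Λ := sum_nonneg fun v _ => (Real.exp_pos _).le
  have hl2 : -(2 * l) ≤ 2 * l := by linarith
  have hsc : Continuous fun u : ℝ => sepPoly b c P Q N₁ N₂ V (t - u) :=
    (continuous_sepPoly b c P Q N₁ N₂ V).comp (continuous_const.sub continuous_id)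
  have hΓc := continuous_gammaFT (2 * l) b₁ b₂
  have h1 := norm_sq_integral_mul_le hΓc hsc hl2
  refine h1.trans (mul_le_mul_of_nonneg_left ?_
    (intervalIntegral.integral_nonneg hl2 fun u _ => norm_nonneg _))
  have hψc : Continuous fun u : ℝ => psiFun b P Q N₁ N₂ V α (t - u) :=
    (continuous_psiFun b P Q N₁ N₂ V α).comp (continuous_const.sub continuous_id)
  calc ∫ u in -(2 * l)..(2 * l), ‖gammaFT (2 * l) b₁ b₂ u‖ * ‖sepPoly b c P Q N₁ N₂ V (t - u)‖ ^ 2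
      ≤ ∫ u in -(2 * l)..(2 * l), ‖gammaFT (2 * l) b₁ b₂ u‖ * (Λ * psiFun b P Q N₁ N₂ V α (t - u)) := by
        refine intervalIntegral.integral_mono_on hl2 ((hΓc.norm.mul (hsc.norm.pow 2)).intervalIntegrable _ _)
          ((hΓc.norm.mul (continuous_const.mul hψc)).intervalIntegrable _ _) fun u hu => ?_
        exact mul_le_mul_of_nonneg_left
          (norm_sq_sepPoly_le_of_good b c P Q N₁ N₂ V α (t - u) (hgood u hu)) (norm_nonneg _)
    _ = Λ * ∫ u in -(2 * l)..(2 * l), ‖gammaFT (2 * l) b₁ b₂ u‖ * psiFun b P Q N₁ N₂ V α (t - u) := by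
        rw [← intervalIntegral.integral_const_mul]
        refine intervalIntegral.integral_congr fun u _ => ?_
        ring

/-! ### `E₁` on the good unit intervals: Fubini, shift, mean values -/

/-- Shifted unit integrals of a continuous `g ≥ 0` over a set `G` of unit intervals below `N_max`
are dominated by one long integral: for `|u| ≤ 2λ` and `T'' ≥ N_max + 1 + 2λ`,
`∑_{n ∈ G} ∫_n^{n+1} g(t - u) dt ≤ ∫_{-T''}^{T''} g`. [folklore] -/
theorem sum_unit_shift_le {g : ℝ → ℝ} (hg : Continuous g) (hg0 : ∀ s, 0 ≤ g s) {l : ℝ}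
    (Nmax : ℕ) (G : Finset ℕ) (hG : ∀ n ∈ G, n ≤ Nmax) {T'' : ℝ} (hT'' : (Nmax : ℝ) + 1 + 2 * l ≤ T'')
    {u : ℝ} (hu : u ∈ Set.Icc (-(2 * l)) (2 * l)) :
    ∑ n ∈ G, ∫ t in (n : ℝ)..((n + 1 : ℕ) : ℝ), g (t - u) ≤ ∫ s in -T''..T'', g s := by
  have hgc : Continuous fun t => g (t - u) := hg.comp (continuous_id.sub continuous_const)
  have hsum : ∑ n ∈ G, ∫ t in (n : ℝ)..((n + 1 : ℕ) : ℝ), g (t - u) ≤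
      ∑ n ∈ Finset.range (Nmax + 1), ∫ t in (n : ℝ)..((n + 1 : ℕ) : ℝ), g (t - u) := by
    refine Finset.sum_le_sum_of_subset_of_nonneg (fun n hn => Finset.mem_range.mpr
      (Nat.lt_succ_of_le (hG n hn))) fun n _ _ => ?_
    exact intervalIntegral.integral_nonneg (by push_cast; linarith) fun t _ => hg0 _
  have hadj : ∑ n ∈ Finset.range (Nmax + 1), ∫ t in (n : ℝ)..((n + 1 : ℕ) : ℝ), g (t - u) =
      ∫ t in (0 : ℝ)..((Nmax + 1 : ℕ) : ℝ), g (t - u) := by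
    have := intervalIntegral.sum_integral_adjacent_intervals (a := fun n : ℕ => (n : ℝ))
      (n := Nmax + 1) (f := fun t => g (t - u)) (μ := volume) (fun k _ => hgc.intervalIntegrable _ _)
    simpa using this
  have hshift : ∫ t in (0 : ℝ)..((Nmax + 1 : ℕ) : ℝ), g (t - u) =
      ∫ s in (0 - u)..(((Nmax + 1 : ℕ) : ℝ) - u), g s :=
    intervalIntegral.integral_comp_sub_right g u
  have hext : ∫ s in (0 - u)..(((Nmax + 1 : ℕ) : ℝ) - u), g s ≤ ∫ s in -T''..T'', g s := by
    obtain ⟨hu1, hu2⟩ := hu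
    refine intervalIntegral.integral_mono_interval ?_ ?_ ?_ (Filter.Eventually.of_forall hg0)
      (hg.intervalIntegrable _ _)
    · linarith
    · push_cast; linarith
    · push_cast; linarith
  exact hsum.trans (hadj.le.trans (hshift.le.trans hext))

/-- The `t ↦ ∫_{-2λ}^{2λ} Γ(u) F(1+i(t-u)) du` is continuous. [folklore] -/
theorem continuous_mainPlus (l b₁ b₂ : ℝ) (b c : ℕ → ℂ) (P Q : ℝ) (N₁ N₂ : ℕ) (V : ℝ) :
    Continuous fun t : ℝ =>
      ∫ u in -(2 * l)..(2 * l), gammaFT (2 * l) b₁ b₂ u * sepPoly b c P Q N₁ N₂ V (t - u) := by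
  refine intervalIntegral.continuous_parametric_intervalIntegral_of_continuous' ?_ _ _
  exact ((continuous_gammaFT (2 * l) b₁ b₂).comp continuous_snd).mul
    ((continuous_sepPoly b c P Q N₁ N₂ V).comp (continuous_fst.sub continuous_snd))

/-- **`E₁` on the good intervals** (the repaired bound): if every shift `t - u`, `|u| ≤ 2λ`, of every
point `t` of the unit intervals `n ∈ G ⊆ [0, N_max]` is good (all `‖Q_v(1+i(t-u))‖ ≤ e^{-αv/V}`), then
`∑_{n ∈ G} ∫_n^{n+1} ‖Main⁺(t)‖² dt ≤ (∫‖Γ‖)² Λ ∑_{v ∈ ℐ} e^{-αv/V} ∫_{-T''}^{T''} ‖R⁺_v(1+is)‖² ds`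
for any `T'' ≥ N_max + 1 + 2λ` — with `Λ = ∑_{v ∈ ℐ} e^{-αv/V} ≍ V P^{-α}/α` appearing ONCE (no
factor `#ℐ`). [cite: Lichtman2020, §5.1, bound for E₁] -/
theorem goodPart_mainPlus_le {l b₁ b₂ : ℝ} (hl : 0 < l) (b c : ℕ → ℂ) (P Q : ℝ) (N₁ N₂ : ℕ)
    (V α : ℝ) (Nmax : ℕ) (G : Finset ℕ) (hG : ∀ n ∈ G, n ≤ Nmax)
    (hgood : ∀ n ∈ G, ∀ t ∈ Set.Icc (n : ℝ) (n + 1), ∀ u ∈ Set.Icc (-(2 * l)) (2 * l),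
      ∀ v ∈ Icc ⌊V * Real.log P⌋₊ ⌊V * Real.log Q⌋₊,
        ‖blockPrimePoly c P Q V v (t - u)‖ ≤ Real.exp (-(α * v / V)))
    {T'' : ℝ} (hT'' : (Nmax : ℝ) + 1 + 2 * l ≤ T'') :
    ∑ n ∈ G, ∫ t in (n : ℝ)..((n + 1 : ℕ) : ℝ),
        ‖∫ u in -(2 * l)..(2 * l), gammaFT (2 * l) b₁ b₂ u * sepPoly b c P Q N₁ N₂ V (t - u)‖ ^ 2 ≤
      (∫ u in -(2 * l)..(2 * l), ‖gammaFT (2 * l) b₁ b₂ u‖) ^ 2 *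
        (∑ v ∈ Icc ⌊V * Real.log P⌋₊ ⌊V * Real.log Q⌋₊, Real.exp (-(α * v / V))) *
        ∑ v ∈ Icc ⌊V * Real.log P⌋₊ ⌊V * Real.log Q⌋₊, Real.exp (-(α * v / V)) *
          ∫ s in -T''..T'', ‖wideCofactorPoly b P Q N₁ N₂ V v s‖ ^ 2 := by
  set ℐ := Icc ⌊V * Real.log P⌋₊ ⌊V * Real.log Q⌋₊ with hℐ
  set Λ := ∑ v ∈ ℐ, Real.exp (-(α * v / V)) with hΛ
  set IΓ := ∫ u in -(2 * l)..(2 * l), ‖gammaFT (2 * l) b₁ b₂ u‖ with hIΓ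
  set Γn : ℝ → ℝ := fun u => ‖gammaFT (2 * l) b₁ b₂ u‖ with hΓn
  set Ψ := psiFun b P Q N₁ N₂ V α with hΨ
  set R : ℕ → ℝ → ℝ := fun v s => ‖wideCofactorPoly b P Q N₁ N₂ V v s‖ ^ 2 with hR
  have hl2 : -(2 * l) ≤ 2 * l := by linarith
  have hΛ0 : 0 ≤ Λ := sum_nonneg fun v _ => (Real.exp_pos _).le
  have hΓnc : Continuous Γn := (continuous_gammaFT (2 * l) b₁ b₂).norm
  have hΓn0 : ∀ u, 0 ≤ Γn u := fun u => norm_nonneg _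
  have hIΓ0 : 0 ≤ IΓ := intervalIntegral.integral_nonneg hl2 fun u _ => norm_nonneg _
  have hΨc : Continuous Ψ := continuous_psiFun b P Q N₁ N₂ V α
  have hRc : ∀ v, Continuous (R v) := fun v => (continuous_wideCofactorPoly b P Q N₁ N₂ V v).norm.pow 2
  have hR0 : ∀ v s, 0 ≤ R v s := fun v s => by positivity
  -- the inner function `φ(t, u) = Γn(u) Ψ(t - u)` and its `u`-integral
  have hφc : Continuous (Function.uncurry fun (t u : ℝ) => Γn u * Ψ (t - u)) :=
    (hΓnc.comp continuous_snd).mul (hΨc.comp (continuous_fst.sub continuous_snd))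
  have hinnerc : Continuous fun t : ℝ => ∫ u in -(2 * l)..(2 * l), Γn u * Ψ (t - u) :=
    intervalIntegral.continuous_parametric_intervalIntegral_of_continuous' hφc _ _
  -- Step 1: pointwise on the good intervals and integration over `[n, n+1]`
  have step1 : ∀ n ∈ G, ∫ t in (n : ℝ)..((n + 1 : ℕ) : ℝ),
      ‖∫ u in -(2 * l)..(2 * l), gammaFT (2 * l) b₁ b₂ u * sepPoly b c P Q N₁ N₂ V (t - u)‖ ^ 2 ≤
      IΓ * Λ * ∫ u in -(2 * l)..(2 * l), ∫ t in (n : ℝ)..((n + 1 : ℕ) : ℝ), Γn u * Ψ (t - u) := by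
    intro n hn
    have hle : (n : ℝ) ≤ ((n + 1 : ℕ) : ℝ) := by push_cast; linarith
    have hmono : ∫ t in (n : ℝ)..((n + 1 : ℕ) : ℝ),
        ‖∫ u in -(2 * l)..(2 * l), gammaFT (2 * l) b₁ b₂ u * sepPoly b c P Q N₁ N₂ V (t - u)‖ ^ 2 ≤
        ∫ t in (n : ℝ)..((n + 1 : ℕ) : ℝ), IΓ * Λ * ∫ u in -(2 * l)..(2 * l), Γn u * Ψ (t - u) := by
      refine intervalIntegral.integral_mono_on hle
        (((continuous_mainPlus l b₁ b₂ b c P Q N₁ N₂ V).norm.pow 2).intervalIntegrable _ _)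
        ((continuous_const.mul hinnerc).intervalIntegrable _ _) fun t ht => ?_
      have ht' : t ∈ Set.Icc (n : ℝ) (n + 1) := by simpa using ht
      have h := norm_sq_mainPlus_le hl b c P Q N₁ N₂ V α t (b₁ := b₁) (b₂ := b₂)
        (fun u hu v hv => hgood n hn t ht' u hu v hv)
      simp only [hΨ, hΓn, hIΓ, hΛ]
      linarith [h]
    refine hmono.trans (le_of_eq ?_)
    rw [intervalIntegral.integral_const_mul]
    congr 1
    exact intervalIntegral_swap_of_continuous hφc hle hl2
  -- Step 2: the inner `t`-integral at fixed `u`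
  have step2 : ∀ (n : ℕ) (u : ℝ), ∫ t in (n : ℝ)..((n + 1 : ℕ) : ℝ), Γn u * Ψ (t - u) =
      Γn u * ∑ v ∈ ℐ, Real.exp (-(α * v / V)) * ∫ t in (n : ℝ)..((n + 1 : ℕ) : ℝ), R v (t - u) := by
    intro n u
    rw [intervalIntegral.integral_const_mul]
    congr 1
    simp only [hΨ, psiFun]
    rw [intervalIntegral.integral_finsetSum]
    · refine sum_congr rfl fun v _ => ?_
      rw [intervalIntegral.integral_const_mul]
    · intro v _
      exact (continuous_const.mul ((hRc v).comp (continuous_id.sub continuous_const))).intervalIntegrable _ _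
  -- Step 3: sum over `n ∈ G`, exchange with the `u`-integral, and bound the shifted unit integrals
  have hhc : ∀ n : ℕ, Continuous fun u : ℝ =>
      Γn u * ∑ v ∈ ℐ, Real.exp (-(α * v / V)) * ∫ t in (n : ℝ)..((n + 1 : ℕ) : ℝ), R v (t - u) := by
    intro n
    refine hΓnc.mul (continuous_finsetSum _ fun v _ => continuous_const.mul ?_)
    have huc : Continuous (Function.uncurry fun (u t : ℝ) => R v (t - u)) :=
      (hRc v).comp (continuous_snd.sub continuous_fst)
    exact intervalIntegral.continuous_parametric_intervalIntegral_of_continuous' huc _ _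
  have step3 : ∑ n ∈ G, ∫ u in -(2 * l)..(2 * l), ∫ t in (n : ℝ)..((n + 1 : ℕ) : ℝ), Γn u * Ψ (t - u) ≤
      IΓ * ∑ v ∈ ℐ, Real.exp (-(α * v / V)) * ∫ s in -T''..T'', R v s := by
    simp_rw [step2]
    rw [← intervalIntegral.integral_finsetSum fun n _ => (hhc n).intervalIntegrable _ _]
    set Mtot := ∑ v ∈ ℐ, Real.exp (-(α * v / V)) * ∫ s in -T''..T'', R v s with hMtot
    calc ∫ u in -(2 * l)..(2 * l), ∑ n ∈ G,
          Γn u * ∑ v ∈ ℐ, Real.exp (-(α * v / V)) * ∫ t in (n : ℝ)..((n + 1 : ℕ) : ℝ), R v (t - u)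
        ≤ ∫ u in -(2 * l)..(2 * l), Γn u * Mtot := by
          refine intervalIntegral.integral_mono_on hl2
            ((continuous_finsetSum _ fun n _ => hhc n).intervalIntegrable _ _)
            ((hΓnc.mul continuous_const).intervalIntegrable _ _) fun u hu => ?_
          rw [← mul_sum]
          refine mul_le_mul_of_nonneg_left ?_ (hΓn0 u)
          rw [sum_comm]
          simp_rw [← mul_sum]
          refine sum_le_sum fun v _ => mul_le_mul_of_nonneg_left ?_ (Real.exp_pos _).le
          exact sum_unit_shift_le (hRc v) (hR0 v) Nmax G hG hT'' hu
      _ = IΓ * Mtot := by rw [intervalIntegral.integral_mul_const]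
  -- conclusion
  calc ∑ n ∈ G, ∫ t in (n : ℝ)..((n + 1 : ℕ) : ℝ),
        ‖∫ u in -(2 * l)..(2 * l), gammaFT (2 * l) b₁ b₂ u * sepPoly b c P Q N₁ N₂ V (t - u)‖ ^ 2
      ≤ ∑ n ∈ G, IΓ * Λ * ∫ u in -(2 * l)..(2 * l), ∫ t in (n : ℝ)..((n + 1 : ℕ) : ℝ), Γn u * Ψ (t - u) :=
        sum_le_sum step1
    _ = IΓ * Λ * ∑ n ∈ G, ∫ u in -(2 * l)..(2 * l), ∫ t in (n : ℝ)..((n + 1 : ℕ) : ℝ), Γn u * Ψ (t - u) :=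
        (Finset.mul_sum _ _ _).symm
    _ ≤ IΓ * Λ * (IΓ * ∑ v ∈ ℐ, Real.exp (-(α * v / V)) * ∫ s in -T''..T'', R v s) :=
        mul_le_mul_of_nonneg_left step3 (mul_nonneg hIΓ0 hΛ0)
    _ = IΓ ^ 2 * Λ * ∑ v ∈ ℐ, Real.exp (-(α * v / V)) * ∫ s in -T''..T'', R v s := by ring

/-! ### Mean values of the wide cofactor polynomials and the sums over the blocks -/

/-- `∑_{1 ≤ n ≤ N} ‖β_n‖² ≤ (k+1)/M` for the standard form of a window `[M, N]` with `N ≤ kM`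
(`‖w‖ ≤ 1`, `M ≥ 1`). [folklore] -/
theorem sum_norm_sq_stdCoeff_le' {w : ℕ → ℂ} (hw : ∀ m, ‖w m‖ ≤ 1) {M N k : ℕ} (hM : 1 ≤ M)
    (hN : N ≤ k * M) :
    ∑ n ∈ Icc 1 N, ‖stdCoeff w M n‖ ^ 2 ≤ ((k : ℝ) + 1) / M := by
  have hM0 : (0 : ℝ) < M := by exact_mod_cast hM
  have hterm : ∀ n ∈ Icc 1 N, ‖stdCoeff w M n‖ ^ 2 ≤ ((M : ℝ) ^ 2)⁻¹ := by
    intro n hn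
    unfold stdCoeff
    split_ifs with h
    · rw [norm_mul, norm_inv, Complex.norm_natCast, mul_pow, inv_pow]
      have h1 : ‖w n‖ ^ 2 ≤ 1 := by
        have := hw n
        have := norm_nonneg (w n)
        nlinarith
      have h2 : ((n : ℝ) ^ 2)⁻¹ ≤ ((M : ℝ) ^ 2)⁻¹ := by
        have : (M : ℝ) ≤ n := by exact_mod_cast h
        gcongr
      calc ‖w n‖ ^ 2 * ((n : ℝ) ^ 2)⁻¹ ≤ 1 * ((M : ℝ) ^ 2)⁻¹ := by gcongr
        _ = ((M : ℝ) ^ 2)⁻¹ := one_mul _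
    · rw [norm_zero, zero_pow two_ne_zero]; positivity
  refine (Finset.sum_le_sum hterm).trans ?_
  rw [Finset.sum_const, nsmul_eq_mul, Nat.card_Icc]
  have hcard : ((N + 1 - 1 : ℕ) : ℝ) ≤ k * M := by
    rw [Nat.add_sub_cancel]; exact_mod_cast hN
  calc ((N + 1 - 1 : ℕ) : ℝ) * ((M : ℝ) ^ 2)⁻¹ ≤ (k * M) * ((M : ℝ) ^ 2)⁻¹ := by gcongr
    _ = k / M := by field_simp
    _ ≤ ((k : ℝ) + 1) / M := by gcongr; linarith

/-- **Mean value bound for a wide window**: for `‖w‖ ≤ 1`, `1 ≤ M`, `N ≤ kM`, `T > 0`,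
`∫_{-T}^{T} |∑_{M ≤ m ≤ N} w_m m^{-1-it}|² dt ≤ (k+1)(5T/M + 18k)` (Lemma 4.1). [cite: Lichtman2020, Lemma 4.1] -/
theorem intervalIntegral_norm_sq_window_le' {w : ℕ → ℂ} (hw : ∀ m, ‖w m‖ ≤ 1) {M N k : ℕ}
    (hM : 1 ≤ M) (hN : N ≤ k * M) {T : ℝ} (hT : 0 < T) :
    ∫ t in -T..T, ‖∑ m ∈ Icc M N, w m * (m : ℂ) ^ (-(1 + (t : ℂ) * I))‖ ^ 2 ≤
      ((k : ℝ) + 1) * (5 * T / M + 18 * k) := by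
  have hM0 : (0 : ℝ) < M := by exact_mod_cast hM
  simp_rw [sum_Icc_eq_stdForm w hM N]
  refine (Literature.NumberTheory.LFunctions.dirichletPolynomial_meanSquare_le (stdCoeff w M) N hT).trans ?_
  have h1 := sum_norm_sq_stdCoeff_le' hw hM hN
  have hNM : (N : ℝ) ≤ k * M := by exact_mod_cast hN
  calc (5 * T + 18 * N) * ∑ n ∈ Icc 1 N, ‖stdCoeff w M n‖ ^ 2
      ≤ (5 * T + 18 * (k * M)) * (((k : ℝ) + 1) / M) := by gcongr
    _ = ((k : ℝ) + 1) * (5 * T / M + 18 * k) := by field_simp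

/-- The coefficients `b_m/(ω(m)+1)` written as `b_m · (1/(ω(m)+1))` are bounded by `1`. [folklore] -/
theorem norm_mul_wt_le {b : ℕ → ℂ} (hb : ∀ m, ‖b m‖ ≤ 1) (P Q : ℝ) (m : ℕ) :
    ‖b m * wt[P, Q, m]‖ ≤ 1 := by
  rw [mul_one_div]
  exact norm_div_primeDivisorsIn_le hb P Q m

/-- **Mean value of a wide cofactor polynomial**: for `‖b‖ ≤ 1`, `N₁ ≥ 1`, `N₂ e^{1/V} ≤ k N₁`, `T > 0`,
`∫_{-T}^{T} ‖R⁺_v(1+is)‖² ds ≤ (k+1)(5T e^{(v+1)/V}/N₁ + 18k)`. [cite: Lichtman2020, Lemma 4.1] -/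
theorem wideCofactor_meanvalue {b : ℕ → ℂ} (hb : ∀ m, ‖b m‖ ≤ 1) (P Q : ℝ) {N₁ N₂ : ℕ} (hN₁ : 1 ≤ N₁)
    {V : ℝ} (hV : 0 < V) {k : ℕ} (hk : (N₂ : ℝ) * Real.exp (1 / V) ≤ k * N₁) (v : ℕ) {T : ℝ}
    (hT : 0 < T) :
    ∫ s in -T..T, ‖wideCofactorPoly b P Q N₁ N₂ V v s‖ ^ 2 ≤
      ((k : ℝ) + 1) * (5 * T * Real.exp (((v : ℝ) + 1) / V) / N₁ + 18 * k) := by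
  set M := ⌈(N₁ : ℝ) * Real.exp (-(((v : ℝ) + 1) / V))⌉₊ with hMdef
  set N := ⌊(N₂ : ℝ) * Real.exp (-((v : ℝ) / V))⌋₊ with hNdef
  have hN₁0 : (0 : ℝ) < N₁ := by exact_mod_cast hN₁
  have hy : 0 < (N₁ : ℝ) * Real.exp (-(((v : ℝ) + 1) / V)) := mul_pos hN₁0 (Real.exp_pos _)
  have hM1 : 1 ≤ M := Nat.one_le_iff_ne_zero.mpr (Nat.ceil_pos.mpr hy).ne'
  have hM0 : (0 : ℝ) < M := by exact_mod_cast hM1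
  have hMge : (N₁ : ℝ) * Real.exp (-(((v : ℝ) + 1) / V)) ≤ M := Nat.le_ceil _
  -- `N ≤ k M`
  have hNkM : N ≤ k * M := by
    have h1 : (N : ℝ) ≤ (N₂ : ℝ) * Real.exp (-((v : ℝ) / V)) := Nat.floor_le (by positivity)
    have e : Real.exp (-((v : ℝ) / V)) = Real.exp (1 / V) * Real.exp (-(((v : ℝ) + 1) / V)) := by
      rw [← Real.exp_add]; congr 1; field_simp; ring
    have h2 : (N₂ : ℝ) * Real.exp (-((v : ℝ) / V)) ≤ k * ((N₁ : ℝ) * Real.exp (-(((v : ℝ) + 1) / V))) := by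
      rw [e, ← mul_assoc]
      calc (N₂ : ℝ) * Real.exp (1 / V) * Real.exp (-(((v : ℝ) + 1) / V))
          ≤ k * N₁ * Real.exp (-(((v : ℝ) + 1) / V)) := mul_le_mul_of_nonneg_right hk (Real.exp_pos _).le
        _ = k * ((N₁ : ℝ) * Real.exp (-(((v : ℝ) + 1) / V))) := by ring
    have h3 : (N : ℝ) ≤ k * M := h1.trans (h2.trans (mul_le_mul_of_nonneg_left hMge (Nat.cast_nonneg k)))
    exact_mod_cast h3
  have key := intervalIntegral_norm_sq_window_le' (w := fun m => b m * wt[P, Q, m])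
    (fun m => norm_mul_wt_le hb P Q m) hM1 hNkM hT
  have hwin : ∀ s, wideCofactorPoly b P Q N₁ N₂ V v s =
      ∑ m ∈ Icc M N, (b m * wt[P, Q, m]) * (m : ℂ) ^ (-(1 + (s : ℂ) * I)) := fun s => rfl
  simp_rw [hwin]
  refine key.trans ?_
  have hk0 : (0 : ℝ) ≤ (k : ℝ) + 1 := by positivity
  refine mul_le_mul_of_nonneg_left ?_ hk0
  -- `1/M ≤ e^{(v+1)/V}/N₁`
  have hinvM : 5 * T / M ≤ 5 * T * Real.exp (((v : ℝ) + 1) / V) / N₁ := by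
    rw [div_le_div_iff₀ hM0 hN₁0]
    have e : Real.exp (((v : ℝ) + 1) / V) * Real.exp (-(((v : ℝ) + 1) / V)) = 1 := by
      rw [← Real.exp_add]; simp
    calc 5 * T * N₁ = 5 * T * Real.exp (((v : ℝ) + 1) / V) * ((N₁ : ℝ) * Real.exp (-(((v : ℝ) + 1) / V))) := by
          rw [show 5 * T * Real.exp (((v : ℝ) + 1) / V) * ((N₁ : ℝ) * Real.exp (-(((v : ℝ) + 1) / V))) =
            5 * T * N₁ * (Real.exp (((v : ℝ) + 1) / V) * Real.exp (-(((v : ℝ) + 1) / V))) by ring, e, mul_one]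
      _ ≤ 5 * T * Real.exp (((v : ℝ) + 1) / V) * M := by
          refine mul_le_mul_of_nonneg_left hMge ?_
          have := Real.exp_pos (((v : ℝ) + 1) / V)
          positivity
  linarith

/-- **An increasing geometric sum**: `∑_{v₀ ≤ v ≤ v₁} e^{sv} ≤ e^{s v₁}(1 + 1/s)` for `s > 0`. [folklore] -/
theorem sum_exp_mul_le {s : ℝ} (hs : 0 < s) (v₀ v₁ : ℕ) :
    ∑ v ∈ Icc v₀ v₁, Real.exp (s * v) ≤ Real.exp (s * v₁) * (1 + 1 / s) := by
  have hterm : ∀ v ∈ Icc v₀ v₁, Real.exp (s * v) = Real.exp (s * v₁) * Real.exp (-(s * ((v₁ - v : ℕ) : ℝ))) := by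
    intro v hv
    have hle : v ≤ v₁ := (mem_Icc.1 hv).2
    rw [← Real.exp_add, Nat.cast_sub hle]
    congr 1; ring
  rw [sum_congr rfl hterm, ← mul_sum]
  refine mul_le_mul_of_nonneg_left ?_ (Real.exp_pos _).le
  -- reflect `v ↦ v₁ - v`
  have hinj : Set.InjOn (fun v : ℕ => v₁ - v) ↑(Icc v₀ v₁) := by
    intro v hv v' hv' h
    have h1 := (mem_Icc.1 (Finset.mem_coe.1 hv)).2
    have h2 := (mem_Icc.1 (Finset.mem_coe.1 hv')).2
    simp only at h
    omega
  have himg : (Icc v₀ v₁).image (fun v : ℕ => v₁ - v) ⊆ Icc 0 v₁ := by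
    intro j hj
    rw [mem_image] at hj
    obtain ⟨v, _, rfl⟩ := hj
    rw [mem_Icc]; omega
  calc ∑ v ∈ Icc v₀ v₁, Real.exp (-(s * ((v₁ - v : ℕ) : ℝ)))
      = ∑ j ∈ (Icc v₀ v₁).image (fun v : ℕ => v₁ - v), Real.exp (-(s * (j : ℝ))) :=
        (sum_image (f := fun j : ℕ => Real.exp (-(s * (j : ℝ)))) hinj).symm
    _ ≤ ∑ j ∈ Icc 0 v₁, Real.exp (-(s * (j : ℝ))) :=
        sum_le_sum_of_subset_of_nonneg himg fun _ _ _ => (Real.exp_pos _).le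
    _ ≤ Real.exp (-(s * ((0 : ℕ) : ℝ))) * (1 + 1 / s) := sum_exp_neg_mul_le hs 0 v₁
    _ = 1 + 1 / s := by simp

/-- **The decreasing block sum** `Λ = ∑_{v ∈ ℐ} e^{-αv/V} ≤ e^{α/V} P^{-α} (1 + V/α)`
(`ℐ = [⌊V log P⌋, v₁]`, `P ≥ 1`, `V, α > 0`). [cite: Lichtman2020, §5.1, bound for E₁] -/
theorem blockSum_le {P V α : ℝ} (hP : 1 ≤ P) (hV : 0 < V) (hα : 0 < α) (v₁ : ℕ) :
    ∑ v ∈ Icc ⌊V * Real.log P⌋₊ v₁, Real.exp (-(α * v / V)) ≤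
      Real.exp (α / V) * P ^ (-α) * (1 + V / α) := by
  set v₀ := ⌊V * Real.log P⌋₊ with hv₀
  have hs : 0 < α / V := by positivity
  have h1 : ∑ v ∈ Icc v₀ v₁, Real.exp (-(α * v / V)) = ∑ v ∈ Icc v₀ v₁, Real.exp (-(α / V * v)) := by
    refine sum_congr rfl fun v _ => ?_; congr 1; ring
  rw [h1]
  refine (sum_exp_neg_mul_le hs v₀ v₁).trans ?_
  have h1s : 1 + 1 / (α / V) = 1 + V / α := by field_simp
  rw [h1s]
  refine mul_le_mul_of_nonneg_right ?_ (by positivity)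
  have hP0 : 0 < P := by linarith
  have hv₀ge : V * Real.log P - 1 ≤ (v₀ : ℝ) := by
    have := Nat.lt_floor_add_one (V * Real.log P)
    rw [hv₀]; linarith
  rw [Real.rpow_def_of_pos hP0, ← Real.exp_add, Real.exp_le_exp]
  have : -(α / V * (v₀ : ℝ)) ≤ -(α / V * (V * Real.log P - 1)) := by
    apply neg_le_neg
    exact mul_le_mul_of_nonneg_left hv₀ge hs.le
  refine this.trans (le_of_eq ?_)
  field_simp
  ring

/-- **The weighted block sum against the windows**:
`∑_{v ∈ ℐ} e^{-αv/V} e^{(v+1)/V} ≤ e^{1/V} Q^{1-α} (1 + V/(1-α))` (`0 < α < 1`, `Q ≥ 1`, `V > 0`).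
[cite: Lichtman2020, §5.1, bound for E₁] -/
theorem blockSum_window_le {Q V α : ℝ} (hQ : 1 ≤ Q) (hV : 0 < V) (hα1 : α < 1) (v₀ : ℕ) :
    ∑ v ∈ Icc v₀ ⌊V * Real.log Q⌋₊, Real.exp (-(α * v / V)) * Real.exp (((v : ℝ) + 1) / V) ≤
      Real.exp (1 / V) * Q ^ (1 - α) * (1 + V / (1 - α)) := by
  set v₁ := ⌊V * Real.log Q⌋₊ with hv₁
  have hs : 0 < (1 - α) / V := by apply div_pos; linarith; exact hV
  have h1 : ∀ v ∈ Icc v₀ v₁, Real.exp (-(α * v / V)) * Real.exp (((v : ℝ) + 1) / V) =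
      Real.exp (1 / V) * Real.exp ((1 - α) / V * v) := by
    intro v _
    rw [← Real.exp_add, ← Real.exp_add]
    congr 1; field_simp; ring
  rw [sum_congr rfl h1, ← mul_sum, mul_assoc]
  refine mul_le_mul_of_nonneg_left ?_ (Real.exp_pos _).le
  refine (sum_exp_mul_le hs v₀ v₁).trans ?_
  have h1s : 1 + 1 / ((1 - α) / V) = 1 + V / (1 - α) := by field_simp
  rw [h1s]
  refine mul_le_mul_of_nonneg_right ?_ (by
    have : 0 < V / (1 - α) := div_pos hV (by linarith)
    linarith)
  have := exp_mul_div_le_rpow hV hQ (show 0 ≤ 1 - α by linarith) (le_refl v₁)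
  rw [show (1 - α) / V * (v₁ : ℝ) = (1 - α) * v₁ / V by ring]
  exact this

/-- **`E₁` on the good intervals, explicit form**: under the hypotheses of `goodPart_mainPlus_le`,
with `‖b‖ ≤ 1`, `N₁ ≥ 1`, `N₂ e^{1/V} ≤ k N₁`, `1 ≤ P ≤ Q`, `0 < α < 1`, `T'' > 0`:
`∑_{n ∈ G} ∫_n^{n+1} ‖Main⁺‖² ≤ (∫‖Γ‖)² Λ (k+1) (5 e^{1/V} (1 + V/(1-α)) Q^{1-α} T''/N₁ + 18 k Λ)`.
[cite: Lichtman2020, §5.1, bound for E₁] -/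
theorem goodPart_mainPlus_le' {l b₁ b₂ : ℝ} (hl : 0 < l) {b : ℕ → ℂ} (hb : ∀ m, ‖b m‖ ≤ 1)
    (c : ℕ → ℂ) {P Q : ℝ} (hP : 1 ≤ P) (hPQ : P ≤ Q) {N₁ N₂ : ℕ} (hN₁ : 1 ≤ N₁) {V : ℝ} (hV : 0 < V)
    {k : ℕ} (hk : (N₂ : ℝ) * Real.exp (1 / V) ≤ k * N₁) {α : ℝ} (hα1 : α < 1)
    (Nmax : ℕ) (G : Finset ℕ) (hG : ∀ n ∈ G, n ≤ Nmax)
    (hgood : ∀ n ∈ G, ∀ t ∈ Set.Icc (n : ℝ) (n + 1), ∀ u ∈ Set.Icc (-(2 * l)) (2 * l),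
      ∀ v ∈ Icc ⌊V * Real.log P⌋₊ ⌊V * Real.log Q⌋₊,
        ‖blockPrimePoly c P Q V v (t - u)‖ ≤ Real.exp (-(α * v / V)))
    {T'' : ℝ} (hT''0 : 0 < T'') (hT'' : (Nmax : ℝ) + 1 + 2 * l ≤ T'') :
    ∑ n ∈ G, ∫ t in (n : ℝ)..((n + 1 : ℕ) : ℝ),
        ‖∫ u in -(2 * l)..(2 * l), gammaFT (2 * l) b₁ b₂ u * sepPoly b c P Q N₁ N₂ V (t - u)‖ ^ 2 ≤
      (∫ u in -(2 * l)..(2 * l), ‖gammaFT (2 * l) b₁ b₂ u‖) ^ 2 *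
        (∑ v ∈ Icc ⌊V * Real.log P⌋₊ ⌊V * Real.log Q⌋₊, Real.exp (-(α * v / V))) *
        (((k : ℝ) + 1) * (5 * Real.exp (1 / V) * (1 + V / (1 - α)) * Q ^ (1 - α) * T'' / N₁
          + 18 * k * ∑ v ∈ Icc ⌊V * Real.log P⌋₊ ⌊V * Real.log Q⌋₊, Real.exp (-(α * v / V)))) := by
  set ℐ := Icc ⌊V * Real.log P⌋₊ ⌊V * Real.log Q⌋₊ with hℐ
  set Λ := ∑ v ∈ ℐ, Real.exp (-(α * v / V)) with hΛ
  have hQ1 : 1 ≤ Q := hP.trans hPQ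
  have hN₁0 : (0 : ℝ) < N₁ := by exact_mod_cast hN₁
  have h1 := goodPart_mainPlus_le hl b c P Q N₁ N₂ V α Nmax G hG hgood hT'' (b₁ := b₁) (b₂ := b₂)
  refine h1.trans (mul_le_mul_of_nonneg_left ?_ ?_)
  swap
  · exact mul_nonneg (sq_nonneg _) (sum_nonneg fun v _ => (Real.exp_pos _).le)
  -- the block mean values
  have hMV : ∀ v ∈ ℐ, Real.exp (-(α * v / V)) * ∫ s in -T''..T'', ‖wideCofactorPoly b P Q N₁ N₂ V v s‖ ^ 2 ≤
      Real.exp (-(α * v / V)) * (((k : ℝ) + 1) * (5 * T'' * Real.exp (((v : ℝ) + 1) / V) / N₁ + 18 * k)) :=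
    fun v _ => mul_le_mul_of_nonneg_left (wideCofactor_meanvalue hb P Q hN₁ hV hk v hT''0) (Real.exp_pos _).le
  refine (sum_le_sum hMV).trans ?_
  have hsplit : ∑ v ∈ ℐ, Real.exp (-(α * v / V)) * (((k : ℝ) + 1) * (5 * T'' * Real.exp (((v : ℝ) + 1) / V) / N₁ + 18 * k)) =
      ((k : ℝ) + 1) * ((5 * T'' / N₁) * ∑ v ∈ ℐ, Real.exp (-(α * v / V)) * Real.exp (((v : ℝ) + 1) / V)
        + 18 * k * Λ) := by
    rw [hΛ, mul_sum, mul_sum, ← sum_add_distrib, mul_sum]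
    refine sum_congr rfl fun v _ => ?_
    ring
  rw [hsplit]
  have hk0 : (0 : ℝ) ≤ (k : ℝ) + 1 := by positivity
  refine mul_le_mul_of_nonneg_left ?_ hk0
  have hws := blockSum_window_le hQ1 hV hα1 ⌊V * Real.log P⌋₊ (α := α)
  have h5 : 0 ≤ 5 * T'' / N₁ := by positivity
  have := mul_le_mul_of_nonneg_left hws h5
  have e : 5 * T'' / ↑N₁ * (Real.exp (1 / V) * Q ^ (1 - α) * (1 + V / (1 - α))) =
      5 * Real.exp (1 / V) * (1 + V / (1 - α)) * Q ^ (1 - α) * T'' / N₁ := by ring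
  linarith

end Literature.NumberTheory.Sieve.Lichtman2020.Smoothed
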